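import Mathlib
import HarnessLib
import Summits.ValiantsHypothesis.ValiantsHypothesis.Theorems.SymmetryDialWalsh

/-!
# SymmetryDial — contingency tables for the Duplicator of (B) («bent ⇒ C³-blind»)

Route `SymmetryDial` (workshop `decomp-valiant`, lens 1, gen 8), item 23711 (P′ = `AffinePebblePairs`);
kernel plan NODE-g8 §5(a) for the typed target (B) `SymmetryDialBent.BentCThreeBlind`.  In the bijective
`3`-pebble game on the affine matrix structures of two group matrices Duplicator answers every move with a
COLOUR-PRESERVING BIJECTION WITH PRESCRIBED VALUES; this file supplies the generic existence lemma and the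
two counting tables that make the colour classes match (the bijections themselves are assembled in
`Theorems/SymmetryDialBentBijections.lean`):
§1 `exists_equiv_fiber_extending` — equal fibre sizes + an injective colour-respecting partial assignment
⇒ a colour-preserving bijection extending it (`Equiv.ofFiberEquiv` + `Equiv.Perm.exists_extending_pair`);
§2 the SHIFT table `four_mul_card_shift`: under a balanced derivative (`Σ_x (−1)^{f x+f(x+u)} = 0`, e.g.
`f` bent, `u ≠ 0`: `SymmetryDialBent.IsBent.autocorr`) `4·#{x : f x = i, f(x+u) = j}` is an explicit
function of `(2^d, wt f)`; §3 the HYPERPLANE table `two_mul_card_hyp` (`θ ≠ 0`: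
`2·#{x : f x = i, [θ·x=0] = j}` is an explicit function of `(2^d, wt f, kerCount f θ)`), and
`kerCount_eq_of_walsh_eq` (`kerCount` is read off `W_f(θ)` and `wt f`).
Nothing here bears on VP ≠ VNP (LADDER-Valiant rung 0); instrument-side infrastructure for P′.
-/

namespace Summit.ValiantsHypothesis.ValiantsHypothesis.Theorems.SymmetryDialBentTables

open Finset
open SymmetryDialAffinePebble (V pair)
open SymmetryDialAffinePebbleThree (kerCount)
open SymmetryDialTranslationOrbits (fin2_ne_zero_iff pair_add card_V)
open SymmetryDialWalsh (chi sgn walsh wt chi_eq_indicator sum_chi sgn_eq_indicator sum_sgn walsh_eq_kerCount)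

/-! ### 1. Colour-preserving bijections with prescribed values -/

section Generic
variable {α β C ι : Type*} [Fintype α] [Fintype β] [DecidableEq C]

/-- Two colourings `κ : α → C`, `κ' : β → C` whose fibres have equal sizes, and an injective partial
assignment `p i ↦ q i` respecting colours, admit a colour-preserving bijection `α ≃ β` extending the
assignment. -/
theorem exists_equiv_fiber_extending [Finite ι] (κ : α → C) (κ' : β → C)
    (h : ∀ c, Fintype.card {a // κ a = c} = Fintype.card {b // κ' b = c})
    (p : ι → α) (q : ι → β) (hp : Function.Injective p) (hq : Function.Injective q)
    (hpq : ∀ i, κ' (q i) = κ (p i)) :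
    ∃ e : α ≃ β, (∀ a, κ' (e a) = κ a) ∧ ∀ i, e (p i) = q i := by
  classical
  have hfib : ∀ c, ∃ ec : {a // κ a = c} ≃ {b // κ' b = c},
      ∀ (i : ι) (hi : κ (p i) = c), (ec ⟨p i, hi⟩ : β) = q i := by
    intro c
    let φ : {a // κ a = c} ≃ {b // κ' b = c} := Fintype.equivOfCardEq (h c)
    let pc : {i : ι // κ (p i) = c} → {b // κ' b = c} := fun i => φ ⟨p i.1, i.2⟩
    let qc : {i : ι // κ (p i) = c} → {b // κ' b = c} := fun i => ⟨q i.1, by rw [hpq]; exact i.2⟩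
    have hpc : Function.Injective pc := by
      intro i j hij
      have h1 := congrArg Subtype.val (φ.injective hij)
      exact Subtype.ext (hp h1)
    have hqc : Function.Injective qc := by
      intro i j hij
      exact Subtype.ext (hq (congrArg Subtype.val hij))
    obtain ⟨σ, hσ⟩ := Equiv.Perm.exists_extending_pair pc qc hpc hqc
    refine ⟨φ.trans σ, fun i hi => ?_⟩
    have h2 := congrArg Subtype.val (hσ ⟨i, hi⟩)
    exact h2
  choose ec hec using hfib
  refine ⟨Equiv.ofFiberEquiv ec, fun a => Equiv.ofFiberEquiv_map ec a, fun i => ?_⟩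
  have h3 : (Equiv.ofFiberEquiv ec (p i) : β) = (ec (κ (p i)) ⟨p i, rfl⟩ : β) := rfl
  rw [h3, hec]

/-- Fibre sizes of a colouring as filtered cardinalities. -/
theorem card_fiber_eq_filter (κ : α → C) (c : C) :
    Fintype.card {a // κ a = c} = ((univ : Finset α).filter fun a => κ a = c).card :=
  Fintype.card_subtype _

end Generic

variable {d : ℕ}

/-! ### 2. The shift contingency table -/

/-- The `0/1` indicator of a Boolean, as an integer. -/
def ind (b : Bool) : ℤ := if b = true then 1 else 0

/-- `(−1)^{f x} = 1 − 2·[f x]`. -/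
theorem sgn_eq_ind (f : V d → Bool) (x : V d) : sgn f x = 1 - 2 * ind (f x) := by
  rw [sgn_eq_indicator]; rfl

/-- `Σ_x [f x] = wt f`. -/
theorem sum_ind (f : V d → Bool) : ∑ x, ind (f x) = (wt f : ℤ) := by
  unfold ind wt
  rw [sum_boole]

/-- `Σ_x [f (x+u)] = wt f`. -/
theorem sum_ind_shift (f : V d → Bool) (u : V d) : ∑ x, ind (f (x + u)) = (wt f : ℤ) := by
  rw [← sum_ind f]
  exact Fintype.sum_equiv (Equiv.addRight u) _ _ fun x => rfl

/-- Balanced derivative in indicator form: `4·Σ_x [f x][f(x+u)] = 4·wt f − 2^d`. -/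
theorem four_mul_sum_ind_mul_shift (f : V d → Bool) (u : V d)
    (h0 : ∑ x, sgn f x * sgn f (x + u) = 0) :
    4 * ∑ x, ind (f x) * ind (f (x + u)) = 4 * (wt f : ℤ) - 2 ^ d := by
  have h1 : ∀ x, sgn f x * sgn f (x + u) =
      1 - 2 * ind (f x) - 2 * ind (f (x + u)) + 4 * (ind (f x) * ind (f (x + u))) := by
    intro x; rw [sgn_eq_ind, sgn_eq_ind]; ring
  have h2 : ∑ x, sgn f x * sgn f (x + u) =
      2 ^ d - 2 * (wt f : ℤ) - 2 * (wt f : ℤ) + 4 * ∑ x, ind (f x) * ind (f (x + u)) := by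
    rw [sum_congr rfl fun x _ => h1 x, sum_add_distrib, sum_sub_distrib, sum_sub_distrib, ← mul_sum,
      ← mul_sum, ← mul_sum, sum_ind, sum_ind_shift, sum_const, card_univ, card_V, nsmul_eq_mul, mul_one]
    push_cast; ring
  rw [h2] at h0
  linarith

/-- The shift contingency table: `4·#{x : f x = i, f(x+u) = j}` as a function of `(2^d, wt f)`. -/
def shiftTable (N w : ℤ) : Bool → Bool → ℤ
  | true, true => 4 * w - N
  | true, false => N
  | false, true => N
  | false, false => 3 * N - 4 * w

/-- **Shift table.**  If the derivative of `f` in direction `u` is balanced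
(`Σ_x (−1)^{f x + f(x+u)} = 0`; e.g. `f` bent and `u ≠ 0`), then for all `i, j`
`4·#{x : f x = i ∧ f(x+u) = j} = shiftTable 2^d (wt f) i j`; in particular these four counts depend only
on `(d, wt f)`. -/
theorem four_mul_card_shift (f : V d → Bool) (u : V d) (h0 : ∑ x, sgn f x * sgn f (x + u) = 0)
    (i j : Bool) :
    4 * (((univ : Finset (V d)).filter fun x => f x = i ∧ f (x + u) = j).card : ℤ) =
      shiftTable (2 ^ d) (wt f) i j := by
  have hTT := four_mul_sum_ind_mul_shift f u h0
  have hT := sum_ind f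
  have hTu := sum_ind_shift f u
  have hN : ∑ _x : V d, (1 : ℤ) = 2 ^ d := by
    rw [sum_const, card_univ, card_V, nsmul_eq_mul, mul_one]; push_cast; rfl
  have hcard : (((univ : Finset (V d)).filter fun x => f x = i ∧ f (x + u) = j).card : ℤ) =
      ∑ x, (if f x = i ∧ f (x + u) = j then (1 : ℤ) else 0) := by
    rw [sum_boole]
  rw [hcard]
  cases i <;> cases j
  · have h1 : ∀ x, (if f x = false ∧ f (x + u) = false then (1 : ℤ) else 0) =
        1 - ind (f x) - ind (f (x + u)) + ind (f x) * ind (f (x + u)) := by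
      intro x; unfold ind; cases f x <;> cases f (x + u) <;> simp
    simp_rw [h1, sum_add_distrib, sum_sub_distrib, hN, hT, hTu]
    simp only [shiftTable]; linarith
  · have h1 : ∀ x, (if f x = false ∧ f (x + u) = true then (1 : ℤ) else 0) =
        ind (f (x + u)) - ind (f x) * ind (f (x + u)) := by
      intro x; unfold ind; cases f x <;> cases f (x + u) <;> simp
    simp_rw [h1, sum_sub_distrib, hTu]
    simp only [shiftTable]; linarith
  · have h1 : ∀ x, (if f x = true ∧ f (x + u) = false then (1 : ℤ) else 0) =
        ind (f x) - ind (f x) * ind (f (x + u)) := by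
      intro x; unfold ind; cases f x <;> cases f (x + u) <;> simp
    simp_rw [h1, sum_sub_distrib, hT]
    simp only [shiftTable]; linarith
  · have h1 : ∀ x, (if f x = true ∧ f (x + u) = true then (1 : ℤ) else 0) =
        ind (f x) * ind (f (x + u)) := by
      intro x; unfold ind; cases f x <;> cases f (x + u) <;> simp
    simp_rw [h1]
    simp only [shiftTable]; linarith

/-! ### 3. The hyperplane contingency table -/

/-- The `0/1` indicator of `θ·x = 0`, as an integer. -/
def kin (θ x : V d) : ℤ := if pair θ x = 0 then 1 else 0

/-- A non-zero dual vector vanishes on exactly half of the points: `2·#{x : θ·x = 0} = 2^d`,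
in indicator form. -/
theorem two_mul_sum_kin {θ : V d} (hθ : θ ≠ 0) : 2 * ∑ x, kin θ x = (2 : ℤ) ^ d := by
  have h1 := sum_chi θ
  rw [if_neg hθ] at h1
  simp_rw [chi_eq_indicator, sum_sub_distrib, ← mul_sum] at h1
  rw [sum_const, card_univ, card_V, nsmul_eq_mul, mul_one] at h1
  unfold kin
  push_cast at h1
  linarith

/-- `Σ_x [f x][θ·x = 0] = kerCount f θ`. -/
theorem sum_ind_mul_kin (f : V d → Bool) (θ : V d) :
    ∑ x, ind (f x) * kin θ x = (kerCount f θ : ℤ) := by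
  unfold ind kin kerCount
  have h1 : ∀ x, ((if f x = true then (1 : ℤ) else 0) * if pair θ x = 0 then 1 else 0) =
      if (f x = true ∧ pair θ x = 0) then 1 else 0 := by
    intro x
    by_cases ha : f x = true <;> by_cases hb : pair θ x = 0 <;> simp [ha, hb]
  simp_rw [h1]
  rw [sum_boole]

/-- The hyperplane contingency table: `2·#{x : f x = i, [θ·x = 0] = j}` as a function of
`(2^d, wt f, kerCount f θ)`. -/
def hypTable (N w k : ℤ) : Bool → Bool → ℤ
  | true, true => 2 * k
  | true, false => 2 * w - 2 * k
  | false, true => N - 2 * k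
  | false, false => N - 2 * w + 2 * k

/-- **Hyperplane table.**  For `θ ≠ 0` and all `i, j`:
`2·#{x : f x = i ∧ [θ·x = 0] = j} = hypTable 2^d (wt f) (kerCount f θ) i j`. -/
theorem two_mul_card_hyp (f : V d → Bool) {θ : V d} (hθ : θ ≠ 0) (i j : Bool) :
    2 * (((univ : Finset (V d)).filter fun x => f x = i ∧ decide (pair θ x = 0) = j).card : ℤ) =
      hypTable (2 ^ d) (wt f) (kerCount f θ) i j := by
  have hK := two_mul_sum_kin hθ
  have hT := sum_ind f
  have hTK := sum_ind_mul_kin f θ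
  have hN : ∑ _x : V d, (1 : ℤ) = 2 ^ d := by
    rw [sum_const, card_univ, card_V, nsmul_eq_mul, mul_one]; push_cast; rfl
  have hcard : (((univ : Finset (V d)).filter fun x => f x = i ∧ decide (pair θ x = 0) = j).card : ℤ) =
      ∑ x, (if f x = i ∧ decide (pair θ x = 0) = j then (1 : ℤ) else 0) := by
    rw [sum_boole]
  rw [hcard]
  cases i <;> cases j
  · have h1 : ∀ x, (if f x = false ∧ decide (pair θ x = 0) = false then (1 : ℤ) else 0) =
        1 - ind (f x) - kin θ x + ind (f x) * kin θ x := by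
      intro x; unfold ind kin; cases f x <;> by_cases hb : pair θ x = 0 <;> simp [hb]
    simp_rw [h1, sum_add_distrib, sum_sub_distrib, hN, hT, hTK]
    simp only [hypTable]; linarith
  · have h1 : ∀ x, (if f x = false ∧ decide (pair θ x = 0) = true then (1 : ℤ) else 0) =
        kin θ x - ind (f x) * kin θ x := by
      intro x; unfold ind kin; cases f x <;> by_cases hb : pair θ x = 0 <;> simp [hb]
    simp_rw [h1, sum_sub_distrib, hTK]
    simp only [hypTable]; linarith
  · have h1 : ∀ x, (if f x = true ∧ decide (pair θ x = 0) = false then (1 : ℤ) else 0) =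
        ind (f x) - ind (f x) * kin θ x := by
      intro x; unfold ind kin; cases f x <;> by_cases hb : pair θ x = 0 <;> simp [hb]
    simp_rw [h1, sum_sub_distrib, hT, hTK]
    simp only [hypTable]; linarith
  · have h1 : ∀ x, (if f x = true ∧ decide (pair θ x = 0) = true then (1 : ℤ) else 0) =
        ind (f x) * kin θ x := by
      intro x; unfold ind kin; cases f x <;> by_cases hb : pair θ x = 0 <;> simp [hb]
    simp_rw [h1, hTK]
    simp only [hypTable]

/-- `kerCount` is read off the Walsh coefficient and the weight: for `θ, θ' ≠ 0`,
`wt f = wt g` and `W_f(θ) = W_g(θ')` give `kerCount f θ = kerCount g θ'`. -/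
theorem kerCount_eq_of_walsh_eq (f g : V d → Bool) {θ θ' : V d} (hθ : θ ≠ 0) (hθ' : θ' ≠ 0)
    (hwt : wt f = wt g) (hw : walsh f θ = walsh g θ') : kerCount f θ = kerCount g θ' := by
  rw [walsh_eq_kerCount, walsh_eq_kerCount, if_neg hθ, if_neg hθ', hwt] at hw
  have : (kerCount f θ : ℤ) = kerCount g θ' := by linarith
  exact_mod_cast this

end Summit.ValiantsHypothesis.ValiantsHypothesis.Theorems.SymmetryDialBentTables
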